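import Summits.QuantumFields.BalabanUV.Beta.FP.PerfectSymbol166RealLineRe

/-!
# `BalabanUV.Beta.FP.PerfectSymbol166SliceDerivCont` — road «FP» (binder row D1), sub-row **W166-HOLO**, PART F: the slice-derivative multipliers
# `DW j μ ν i` are JOINTLY CONTINUOUS on the open fat strip (Cauchy integral representation with a locally uniform radius + dominated convergence),
# hence `s ↦ DW j μ ν i (ofRealVec s)` and the real weights `reDW j μ ν i` are continuous on an open box containing the closed Brillouin zone —
# the `ContinuousOn … (BZ (d+1))` input from which `PuncturedCoordDeriv` §3 ∕ `BrillouinRadial` make the `IntegrableOn` hypotheses (`hint`) of the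
# integration-by-parts chains for every member containing a `W_∞`-derivative (rows H2-P-B, H2-P-KER-ASM)

HONEST FRAMING (cell contract, verbatim): «discharging `BetaPertH` makes Bałaban's UV stability UNCONDITIONAL — a real constructive-QFT
result; it is NOT the continuum limit and NOT the Clay problem.»  HONEST DEPENDENCY (verbatim): «continuum YM on T⁴ ⇐ BetaPertH ∧ nine
spine estimates (0/9 proved); BetaPertH ⇐ (D1) ∧ (D4) ∧ CAP+tail; G-an2-4 gates asym, D1 and NE2/3/4.»  THIS MODULE DISCHARGES NOTHING of
D1 / BetaPertH: [folklore] one-variable complex analysis (Cauchy's integral formula for derivatives, Mathlib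
`DifferentiableOn.circleIntegral_one_div_sub_center_pow_smul`; continuity of a parametric interval integral under a uniform bound,
`intervalIntegral.continuousAt_of_dominated_interval`) over PARTS B∕D∕E (`delta166`, `bound166`, `continuousOn_W166Inf_fatStrip`,
`differentiableAt_W166Inf_slice_fatStripO`, `DW`, `reDW`) BY NAME.  No `def … : Prop`; nothing is cited; 0 sorry.  NOT summit progress; NOT
BetaPertH, NOT continuum, NOT Clay.

ABSOLUTE RULE (cell, verbatim): «No internally-minted statement may enter as a cited fact. Every hypothesis is either kernel-proved in this
package or a verbatim quotation of a PUBLISHED theorem with page reference. The manuscript(s) under audit are NOT citable for their own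
disputed steps — they are the thing under adjudication; programme-internal (2001/route/tribunal) claims are never citable.»

CONTENT (dimension `n`, `Ω := FatStripO n (κ₁₆₆ n) (δ₁₆₆ n)` the open fat strip of PART B, sup metric on `Fin n → ℂ`).
* §1 geometry: `isOpen_fatStripO`, `update_mem_of_ball` (for `p ∈ ball p₀ ρ` and `|z − p i| ≤ ρ` the updated point is within `2ρ` of `p₀`),
  `differentiableOn_slice_closedBall` (the slice `z ↦ W_∞(update p i z)` is holomorphic on `closedBall (p i) ρ` once `ball p₀ (2ρ) ⊆ Ω`).
* §2 the CAUCHY REPRESENTATION with a locally uniform radius: `DW_eq_smul_circleIntegral`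
  (`DW j μ ν i p = (j!∕(2πI)) • ∮_{C(p i, ρ)} (z − p i)^{−(j+1)} • W_∞(update p i z)`), the integrand written on the parameter interval
  (`cauchyIntegrand`, `circleIntegral_eq_intervalIntegral_cauchyIntegrand`), its continuity in the angle ∕ in the base point, and its uniform bound.
* §3 **`continuousOn_DW : ContinuousOn (DW j μ ν i) (FatStripO n (κ₁₆₆ n) (δ₁₆₆ n))`** (every `j μ ν i`); real corollaries
  **`continuousOn_DW_ofRealVec`** (on the open real box `{∀ ν, |s ν| < π + δ₁₆₆}`), **`continuousOn_DW_ofRealVec_BZ`** (on the closed zone `BZ n`),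
  **`continuousOn_reDW`** ∕ **`continuousOn_reDW_BZ`** (the real weights of PART E).
Unit `b2b-balaban-beta-d1-formalise-leaf-01` (gen 8).
-/

noncomputable section

namespace Summit.QuantumFields.BalabanUV.Beta.FP.PerfectSymbol166SliceDerivCont

open Filter Topology Complex Set Metric MeasureTheory
open Literature.MathematicalPhysics.QuantumFieldTheory.Balaban1983to89
open B4Strip (ofRealVec)
open B5Symbol166Strip (kappa166 kappa166_pos)
open B4ContourShift (BZ)
open Summit.QuantumFields.BalabanUV.Beta.FP.PerfectSymbol166
open Summit.QuantumFields.BalabanUV.Beta.FP.PerfectSymbol166StripReg (FatStrip FatStripO fatStripO_subset_fatStrip delta166 delta166_pos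
  bound166 bound166_nonneg continuousOn_W166Inf_fatStrip differentiableAt_W166Inf_slice_fatStripO norm_W166Inf_le_bound166)
open Summit.QuantumFields.BalabanUV.Beta.FP.PerfectSymbol166RealLine (DW)
open Summit.QuantumFields.BalabanUV.Beta.FP.PerfectSymbol166RealLineRe (reDW)

variable {n : ℕ}

/-! ## §1 Geometry of the open fat strip in the sup metric -/

/-- [folklore] the open fat strip is open. -/
theorem isOpen_fatStripO (n : ℕ) (κ δ : ℝ) : IsOpen (FatStripO n κ δ) := by
  have e : FatStripO n κ δ = ⋂ ν : Fin n, {q : Fin n → ℂ | |(q ν).re| < Real.pi + δ} ∩ {q | |(q ν).im| < κ + δ} := by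
    ext q; simp [FatStripO, Set.mem_iInter]
  rw [e]
  refine isOpen_iInter_of_finite fun ν => IsOpen.inter ?_ ?_
  · exact isOpen_lt (continuous_abs.comp (Complex.continuous_re.comp (continuous_apply ν))) continuous_const
  · exact isOpen_lt (continuous_abs.comp (Complex.continuous_im.comp (continuous_apply ν))) continuous_const

/-- [folklore] for `p ∈ ball p₀ ρ` and `‖z − p i‖ ≤ ρ` the updated point `update p i z` lies in `ball p₀ (2ρ)` (sup metric). -/
theorem update_mem_ball {p₀ p : Fin n → ℂ} {ρ : ℝ} (hρ : 0 < ρ) (hp : p ∈ ball p₀ ρ) (i : Fin n) {z : ℂ} (hz : dist z (p i) ≤ ρ) :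
    Function.update p i z ∈ ball p₀ (2 * ρ) := by
  rw [mem_ball] at hp ⊢
  have hp' := (dist_pi_lt_iff hρ).mp hp
  refine (dist_pi_lt_iff (by linarith)).mpr fun ν => ?_
  by_cases h : ν = i
  · subst h
    rw [Function.update_self]
    calc dist z (p₀ ν) ≤ dist z (p ν) + dist (p ν) (p₀ ν) := dist_triangle _ _ _
      _ < ρ + ρ := add_lt_add_of_le_of_lt hz (hp' ν)
      _ = 2 * ρ := by ring
  · rw [Function.update_of_ne h]
    linarith [hp' ν]

/-- [folklore] **the slice is holomorphic on a closed disc of locally uniform radius**: if `ball p₀ (2ρ) ⊆ Ω` (the open fat strip) and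
`p ∈ ball p₀ ρ`, then `z ↦ W_∞(μ,ν; update p i z)` is (complex) differentiable on `closedBall (p i) ρ`. -/
theorem differentiableOn_slice_closedBall {p₀ p : Fin n → ℂ} {ρ : ℝ} (hρ : 0 < ρ)
    (hΩ : ball p₀ (2 * ρ) ⊆ FatStripO n (kappa166 n) (delta166 n)) (hp : p ∈ ball p₀ ρ) (i μ ν : Fin n) :
    DifferentiableOn ℂ (fun z : ℂ => W166Inf μ ν (Function.update p i z)) (closedBall (p i) ρ) := by
  intro z hz
  have hmem : Function.update p i z ∈ FatStripO n (kappa166 n) (delta166 n) := hΩ (update_mem_ball hρ hp i (mem_closedBall.mp hz))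
  have h := differentiableAt_W166Inf_slice_fatStripO hmem i μ ν
  simp only [Function.update_idem, Function.update_self] at h
  exact h.differentiableWithinAt

/-! ## §2 The Cauchy representation of `DW j` with a locally uniform radius -/

/-- [our object] the Cauchy integrand on the parameter interval: `θ ↦ (circleMap 0 ρ θ · I) • ((circleMap 0 ρ θ)^{j+1})⁻¹ • W_∞(update p i (p i + circleMap 0 ρ θ))`. -/
def cauchyIntegrand (j : ℕ) (μ ν i : Fin n) (ρ : ℝ) (p : Fin n → ℂ) (θ : ℝ) : ℂ :=
  (circleMap 0 ρ θ * I) • ((1 / (circleMap 0 ρ θ) ^ (j + 1)) • W166Inf μ ν (Function.update p i (p i + circleMap 0 ρ θ)))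

/-- [folklore] the circle integral of `(z − p i)^{−(j+1)} • W_∞(update p i z)` IS the interval integral of `cauchyIntegrand`. -/
theorem circleIntegral_eq_intervalIntegral_cauchyIntegrand (j : ℕ) (μ ν i : Fin n) (ρ : ℝ) (p : Fin n → ℂ) :
    (∮ z in C(p i, ρ), (1 / (z - p i) ^ (j + 1)) • W166Inf μ ν (Function.update p i z))
      = ∫ θ in (0 : ℝ)..2 * Real.pi, cauchyIntegrand j μ ν i ρ p θ := by
  rw [circleIntegral]
  refine intervalIntegral.integral_congr fun θ _ => ?_
  simp only [cauchyIntegrand, deriv_circleMap, circleMap_sub_center]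
  congr 2
  rw [← circleMap_sub_center (p i) ρ θ, add_sub_cancel]

/-- [folklore] **CAUCHY REPRESENTATION OF THE MULTIPLIER**: under the hypotheses of `differentiableOn_slice_closedBall`,
`DW j μ ν i p = ((2πI∕j!)⁻¹) • ∫_0^{2π} cauchyIntegrand j μ ν i ρ p θ dθ`. -/
theorem DW_eq_smul_intervalIntegral {p₀ p : Fin n → ℂ} {ρ : ℝ} (hρ : 0 < ρ)
    (hΩ : ball p₀ (2 * ρ) ⊆ FatStripO n (kappa166 n) (delta166 n)) (hp : p ∈ ball p₀ ρ) (j : ℕ) (i μ ν : Fin n) :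
    DW j μ ν i p = (2 * Real.pi * I / (j.factorial : ℂ))⁻¹ • ∫ θ in (0 : ℝ)..2 * Real.pi, cauchyIntegrand j μ ν i ρ p θ := by
  have hC := (differentiableOn_slice_closedBall hρ hΩ hp i μ ν).circleIntegral_one_div_sub_center_pow_smul hρ j
  rw [circleIntegral_eq_intervalIntegral_cauchyIntegrand] at hC
  have hne : (2 * Real.pi * I / (j.factorial : ℂ)) ≠ 0 := by
    apply div_ne_zero
    · exact mul_ne_zero (mul_ne_zero two_ne_zero (Complex.ofReal_ne_zero.mpr Real.pi_ne_zero)) Complex.I_ne_zero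
    · exact_mod_cast j.factorial_ne_zero
  unfold DW
  rw [hC, smul_smul, inv_mul_cancel₀ hne, one_smul]

/-- [folklore] for `p ∈ ball p₀ ρ` the circle `p i + circleMap 0 ρ θ` stays in the closed fat strip (where `W_∞` is continuous and bounded). -/
theorem update_circle_mem_fatStrip {p₀ p : Fin n → ℂ} {ρ : ℝ} (hρ : 0 < ρ)
    (hΩ : ball p₀ (2 * ρ) ⊆ FatStripO n (kappa166 n) (delta166 n)) (hp : p ∈ ball p₀ ρ) (i : Fin n) (θ : ℝ) :
    Function.update p i (p i + circleMap 0 ρ θ) ∈ FatStrip n (kappa166 n) (delta166 n) := by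
  refine fatStripO_subset_fatStrip _ _ (hΩ (update_mem_ball hρ hp i ?_))
  rw [dist_eq_norm, add_sub_cancel_left, norm_circleMap_zero, abs_of_pos hρ]

/-- [folklore] the circle points are non-zero: `circleMap 0 ρ θ ^ (j+1) ≠ 0` for `ρ > 0`. -/
theorem circleMap_pow_ne_zero {ρ : ℝ} (hρ : 0 < ρ) (θ : ℝ) (j : ℕ) : circleMap 0 ρ θ ^ (j + 1) ≠ 0 :=
  pow_ne_zero _ (by rw [← norm_ne_zero_iff, norm_circleMap_zero, abs_of_pos hρ]; exact hρ.ne')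

/-- [folklore] **continuity of the Cauchy integrand IN THE ANGLE** (for a fixed admissible `p`): measurability input of the dominated-convergence
lemma. -/
theorem continuous_cauchyIntegrand_angle {p₀ p : Fin n → ℂ} {ρ : ℝ} (hρ : 0 < ρ)
    (hΩ : ball p₀ (2 * ρ) ⊆ FatStripO n (kappa166 n) (delta166 n)) (hp : p ∈ ball p₀ ρ) (j : ℕ) (μ ν i : Fin n) :
    Continuous fun θ : ℝ => cauchyIntegrand j μ ν i ρ p θ := by
  have hupd : Continuous fun θ : ℝ => Function.update p i (p i + circleMap 0 ρ θ) := by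
    apply continuous_pi
    intro ν'
    by_cases h : ν' = i
    · subst h; simp only [Function.update_self]; exact continuous_const.add (continuous_circleMap 0 ρ)
    · simp only [Function.update_of_ne h]; exact continuous_const
  have hW : Continuous fun θ : ℝ => W166Inf μ ν (Function.update p i (p i + circleMap 0 ρ θ)) :=
    (continuousOn_W166Inf_fatStrip μ ν).comp_continuous hupd fun θ => update_circle_mem_fatStrip hρ hΩ hp i θ
  have hc : Continuous fun θ : ℝ => circleMap 0 ρ θ := continuous_circleMap 0 ρ
  have h1 : Continuous fun θ : ℝ => (1 : ℂ) / circleMap 0 ρ θ ^ (j + 1) :=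
    continuous_const.div (hc.pow _) fun θ => circleMap_pow_ne_zero hρ θ j
  unfold cauchyIntegrand
  exact (hc.mul continuous_const).smul (h1.smul hW)

/-- [folklore] **continuity of the Cauchy integrand IN THE BASE POINT** (for a fixed angle), on `ball p₀ ρ`. -/
theorem continuousOn_cauchyIntegrand_base {p₀ : Fin n → ℂ} {ρ : ℝ} (hρ : 0 < ρ)
    (hΩ : ball p₀ (2 * ρ) ⊆ FatStripO n (kappa166 n) (delta166 n)) (j : ℕ) (μ ν i : Fin n) (θ : ℝ) :
    ContinuousOn (fun p : Fin n → ℂ => cauchyIntegrand j μ ν i ρ p θ) (ball p₀ ρ) := by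
  have hupd : Continuous fun p : Fin n → ℂ => Function.update p i (p i + circleMap 0 ρ θ) := by
    apply continuous_pi
    intro ν'
    by_cases h : ν' = i
    · subst h; simp only [Function.update_self]; exact (continuous_apply ν').add continuous_const
    · simp only [Function.update_of_ne h]; exact continuous_apply ν'
  have hW : ContinuousOn (fun p : Fin n → ℂ => W166Inf μ ν (Function.update p i (p i + circleMap 0 ρ θ))) (ball p₀ ρ) :=
    (continuousOn_W166Inf_fatStrip μ ν).comp hupd.continuousOn fun p hp => update_circle_mem_fatStrip hρ hΩ hp i θ
  unfold cauchyIntegrand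
  exact (continuousOn_const (c := circleMap 0 ρ θ * I)).smul ((continuousOn_const (c := (1 : ℂ) / circleMap 0 ρ θ ^ (j + 1))).smul hW)

/-- [folklore] **uniform bound of the Cauchy integrand**: `‖cauchyIntegrand j μ ν i ρ p θ‖ ≤ ρ·(ρ^{j+1})⁻¹·M₁₆₆(n)` for `p ∈ ball p₀ ρ`. -/
theorem norm_cauchyIntegrand_le {p₀ p : Fin n → ℂ} {ρ : ℝ} (hρ : 0 < ρ)
    (hΩ : ball p₀ (2 * ρ) ⊆ FatStripO n (kappa166 n) (delta166 n)) (hp : p ∈ ball p₀ ρ) (j : ℕ) (μ ν i : Fin n) (θ : ℝ) :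
    ‖cauchyIntegrand j μ ν i ρ p θ‖ ≤ ρ * (ρ ^ (j + 1))⁻¹ * bound166 n := by
  unfold cauchyIntegrand
  rw [norm_smul, norm_smul, norm_mul, Complex.norm_I, mul_one, norm_circleMap_zero, abs_of_pos hρ, norm_div, norm_one, norm_pow,
    norm_circleMap_zero, abs_of_pos hρ, one_div]
  have hW := norm_W166Inf_le_bound166 μ ν (update_circle_mem_fatStrip hρ hΩ hp i θ)
  have h1 : 0 ≤ ρ * (ρ ^ (j + 1))⁻¹ := by positivity
  calc ρ * ((ρ ^ (j + 1))⁻¹ * ‖W166Inf μ ν (Function.update p i (p i + circleMap 0 ρ θ))‖)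
      = ρ * (ρ ^ (j + 1))⁻¹ * ‖W166Inf μ ν (Function.update p i (p i + circleMap 0 ρ θ))‖ := by ring
    _ ≤ ρ * (ρ ^ (j + 1))⁻¹ * bound166 n := mul_le_mul_of_nonneg_left hW h1

/-! ## §3 Joint continuity of `DW j` and the real corollaries -/

/-- [folklore] **THE SLICE-DERIVATIVE MULTIPLIERS ARE JOINTLY CONTINUOUS ON THE OPEN FAT STRIP**:
`ContinuousOn (DW j μ ν i) (FatStripO n (κ₁₆₆ n) (δ₁₆₆ n))` for every `j μ ν i` (Cauchy representation with a locally uniform radius + dominated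
convergence with a constant majorant). -/
theorem continuousOn_DW (j : ℕ) (μ ν i : Fin n) : ContinuousOn (DW j μ ν i) (FatStripO n (kappa166 n) (delta166 n)) := by
  intro p₀ hp₀
  -- a locally uniform radius
  obtain ⟨ε, hε, hball⟩ := Metric.isOpen_iff.mp (isOpen_fatStripO n (kappa166 n) (delta166 n)) p₀ hp₀
  set ρ : ℝ := ε / 2 with hρdef
  have hρ : 0 < ρ := by positivity
  have hΩ : ball p₀ (2 * ρ) ⊆ FatStripO n (kappa166 n) (delta166 n) := by
    have : 2 * ρ = ε := by rw [hρdef]; ring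
    rw [this]; exact hball
  -- continuity at `p₀` of the parametric integral
  have hint : ContinuousAt (fun p => ∫ θ in (0 : ℝ)..2 * Real.pi, cauchyIntegrand j μ ν i ρ p θ) p₀ := by
    have hmem : ∀ᶠ p in 𝓝 p₀, p ∈ ball p₀ ρ := isOpen_ball.mem_nhds (mem_ball_self hρ)
    refine intervalIntegral.continuousAt_of_dominated_interval (bound := fun _ => ρ * (ρ ^ (j + 1))⁻¹ * bound166 n) ?_ ?_ ?_ ?_
    · filter_upwards [hmem] with p hp
      exact (continuous_cauchyIntegrand_angle hρ hΩ hp j μ ν i).aestronglyMeasurable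
    · filter_upwards [hmem] with p hp
      exact Eventually.of_forall fun θ _ => norm_cauchyIntegrand_le hρ hΩ hp j μ ν i θ
    · exact intervalIntegrable_const
    · refine Eventually.of_forall fun θ _ => ?_
      exact (continuousOn_cauchyIntegrand_base hρ hΩ j μ ν i θ).continuousAt (isOpen_ball.mem_nhds (mem_ball_self hρ))
  -- `DW` agrees with the (scaled) parametric integral near `p₀`
  have hev : (fun p => (2 * Real.pi * I / (j.factorial : ℂ))⁻¹ • ∫ θ in (0 : ℝ)..2 * Real.pi, cauchyIntegrand j μ ν i ρ p θ)
      =ᶠ[𝓝 p₀] DW j μ ν i := by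
    filter_upwards [isOpen_ball.mem_nhds (mem_ball_self hρ)] with p hp
    exact (DW_eq_smul_intervalIntegral hρ hΩ hp j i μ ν).symm
  have h2 : ContinuousAt (fun p => (2 * Real.pi * I / (j.factorial : ℂ))⁻¹ •
      ∫ θ in (0 : ℝ)..2 * Real.pi, cauchyIntegrand j μ ν i ρ p θ) p₀ :=
    Filter.Tendsto.const_smul hint ((2 * Real.pi * I / (j.factorial : ℂ))⁻¹)
  exact (h2.congr hev).continuousWithinAt

/-- [our object] the OPEN REAL BOX `{∀ ν, |s ν| < π + δ}`. -/
def realBoxO (n : ℕ) (δ : ℝ) : Set (Fin n → ℝ) := {s | ∀ ν, |s ν| < Real.pi + δ}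

/-- [folklore] the closed Brillouin zone lies in the open real box of any positive fattening. -/
theorem BZ_subset_realBoxO {δ : ℝ} (hδ : 0 < δ) : BZ n ⊆ realBoxO n δ := fun s hs ν => by
  have := abs_le.mpr ⟨hs.1 ν, hs.2 ν⟩; exact lt_of_le_of_lt this (by linarith)

/-- [folklore] a real point of the open box, complexified, lies in the open fat strip. -/
theorem ofRealVec_mem_fatStripO {s : Fin n → ℝ} (hs : s ∈ realBoxO n (delta166 n)) :
    ofRealVec s ∈ FatStripO n (kappa166 n) (delta166 n) := fun ν => by
  refine ⟨by simpa [ofRealVec] using hs ν, ?_⟩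
  simp only [ofRealVec, Complex.ofReal_im, abs_zero]
  linarith [kappa166_pos n, delta166_pos n]

/-- [folklore] **`s ↦ DW j μ ν i (ofRealVec s)` IS CONTINUOUS ON THE OPEN REAL BOX** `{|s ν| < π + δ₁₆₆}`. -/
theorem continuousOn_DW_ofRealVec (j : ℕ) (μ ν i : Fin n) :
    ContinuousOn (fun s : Fin n → ℝ => DW j μ ν i (ofRealVec s)) (realBoxO n (delta166 n)) :=
  (continuousOn_DW j μ ν i).comp B4ContourShift.continuous_ofRealVec.continuousOn fun _ hs => ofRealVec_mem_fatStripO hs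

/-- [folklore] … in particular on the closed Brillouin zone `BZ n` — the `ContinuousOn` input of the `IntegrableOn` hypotheses of the
integration-by-parts chains (`PuncturedCoordDeriv` §3) for every member containing a `W_∞`-derivative. -/
theorem continuousOn_DW_ofRealVec_BZ (j : ℕ) (μ ν i : Fin n) :
    ContinuousOn (fun s : Fin n → ℝ => DW j μ ν i (ofRealVec s)) (BZ n) :=
  (continuousOn_DW_ofRealVec j μ ν i).mono (BZ_subset_realBoxO (delta166_pos n))

/-- [folklore] **THE REAL WEIGHTS `reDW j μ ν i` ARE CONTINUOUS ON THE OPEN REAL BOX.** -/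
theorem continuousOn_reDW (j : ℕ) (μ ν i : Fin n) : ContinuousOn (reDW j μ ν i) (realBoxO n (delta166 n)) := by
  have h := Complex.continuous_re.comp_continuousOn (continuousOn_DW_ofRealVec j μ ν i)
  exact h.congr fun s _ => rfl

/-- [folklore] … and on the closed Brillouin zone. -/
theorem continuousOn_reDW_BZ (j : ℕ) (μ ν i : Fin n) : ContinuousOn (reDW j μ ν i) (BZ n) :=
  (continuousOn_reDW j μ ν i).mono (BZ_subset_realBoxO (delta166_pos n))

/-- [folklore] the real weights are continuous at every point of the closed zone (the open box is a neighbourhood). -/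
theorem continuousAt_reDW (j : ℕ) (μ ν i : Fin n) {s : Fin n → ℝ} (hs : s ∈ BZ n) : ContinuousAt (reDW j μ ν i) s := by
  have hO : IsOpen (realBoxO n (delta166 n)) := by
    have e : realBoxO n (delta166 n) = ⋂ ν : Fin n, {s : Fin n → ℝ | |s ν| < Real.pi + delta166 n} := by
      ext s; simp [realBoxO, Set.mem_iInter]
    rw [e]
    exact isOpen_iInter_of_finite fun ν => isOpen_lt (continuous_abs.comp (continuous_apply ν)) continuous_const
  exact (continuousOn_reDW j μ ν i).continuousAt (hO.mem_nhds (BZ_subset_realBoxO (delta166_pos n) hs))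

end Summit.QuantumFields.BalabanUV.Beta.FP.PerfectSymbol166SliceDerivCont

end
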